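import Summits.BirchSwinnertonDyer.BirchSwinnertonDyer.Theorems.PrintCFramBottomClassIndexLawFiveLeBorelKummerLine
import Summits.BirchSwinnertonDyer.BirchSwinnertonDyer.Theorems.PrintCFramBottomClassIndexLawFiveLeBorelH1VanishingCompositum
import Literature.NumberTheory.EllipticCurves.KummerMap
import HarnessLib

/-!
# Route `PrintCFram`, crux C2 `BottomClassIndexLawFiveLe` (stmt-BirchSwinnertonDyer-20372), line
# `eisenstein-resource-bdp-line` (S2 `stub_kolyvaginUpper_borelCM_pairSum`, the new hypothesis on
# rational points): **over `F ∋ √−p` the Kummer class of `P ∈ W(F)` leaves the line `W[𝔭]` iff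
# `P ∉ √−p · W(F)`** — the Borel-prime analogue of Gross's `δ(y_K)|_{Gal(L̄/L)} ≠ 0 ⟺ y_K ∉ pE(K)`
# (cell `bsd-print-cfram`, seat `bsd-line-cfram-p1-w2` g5; helper `--supports` 20372; 0 facts, 0 defs)

HONEST FRAMING. Nothing about BSD is proved here, and nothing of S2 itself. File 8g read the
hypothesis of the uniserial Prop. 9.3 («some evaluation of `κ_Q` lies off `W[𝔭]`») as
`μ_F P ∉ p · W(F̄)^{Γ_{F(W[p])}}`. Over a number field `F ∋ √−p` with `(p−1) ∤ [F:ℚ]` (the compositum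
`K·K''` of the S2 memo) this file DESCENDS it to `F`-rational points, using the two inputs of file 9
(route III): (α) `H¹(F(W[p])/F, W[p]) = 0` turns «`μ_F P = pR` with `R` fixed by `Γ_{F(W[p])}`» into
«… with `R ∈ W(F)`» (the cocycle `γ ↦ γR − R` is a Kummer class dying on `Γ_{F(W[p])}`, hence zero,
hence `R ∈ W(F) + W[p]`); (β) `W[p]^{Γ_F} = 0` and `μ² = ±p` turn «`μ_F P ∈ p·W(F)`» into
«`P ∈ μ_F·W(F)`».
* §1 `apply_smul_eq_of_sqrt_mem` (all of `Γ_F` commutes with `μ_F = e μ e⁻¹` when `√−p ∈ F`),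
  `exists_homothety_geomTorsion_of_sqrt_mem` (the level-`p` central homothety of file 9 in the
  machine's currency `W(F̄)[p]`).
* §2 END STATES for `W` CM, `p ≥ 5` CM-ramified, `μ = √−p` with its sign rule, `F ∋ √−p`,
  `(p−1) ∤ [F:ℚ]`, `P ∈ W(F)`, `pQ = P`:
  `exists_h1Eval_kummer_ne_iff_not_mem_smul_of_sqrt_mem` (`κ_Q` leaves `W[𝔭]` iff
  `μ_F P ∉ p·W(F)`) and **`exists_h1Eval_kummer_ne_iff_not_mem_range_of_sqrt_mem`** (iff
  `P ∉ μ_F·W(F)`, i.e. `P` is not `𝔭`-divisible in `W(F)`).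
So the `r = 1` input of the Borel Prop. 9.3 / McCallum 3.1 for the Heegner class is the statement
«`y ∉ 𝔭·W(F)`», whose failure is measured by the `𝔭`-ADIC valuation of the index — the quantity the
pair-sum form of S2 symmetrises over `W ↔ W/W[𝔭]`. THEOREMS ONLY; no definition, no named fact, no
`sorry`. BSD is not proved by any of this; no summit statement is proved by this seat.
References: [GrossLMS1991] §9 (Prop. 9.1, 9.3 and the pairing); [SilvermanAEC2009] VIII.2;
[Rubin1999] Cor. 5.5, Lemma 6.2.
-/

set_option autoImplicit false
-- `…BirchSwinnertonDyer.BirchSwinnertonDyer.Theorems…` is the problem's mandated namespace (D-0017).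
set_option linter.dupNamespace false

noncomputable section

open scoped Classical

namespace Summit.BirchSwinnertonDyer.BirchSwinnertonDyer.Theorems.PrintCFram.BorelKolyvaginPairing

open WeierstrassCurve Field Literature.NumberTheory.EllipticCurves
  Literature.NumberTheory.EllipticCurves.KolyvaginPairing Literature.NumberTheory.GaloisRepresentations
  Literature.NumberTheory.EllipticCurves.Rank1Residual
  Summit.BirchSwinnertonDyer.BirchSwinnertonDyer.Theorems.PrintCFram.BorelHomothety
  Summit.BirchSwinnertonDyer.BirchSwinnertonDyer.Theorems.GenusKolyTwistingPrime

section Descent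

variable (W : WeierstrassCurve ℚ) [W.IsElliptic] (p : ℕ) [hp : Fact p.Prime]
variable (F : Type) [Field F] [NumberField F]

omit [W.IsElliptic] hp in
/-- **All of `Γ_F` commutes with `μ_F = e μ e⁻¹` when `√−p ∈ F`.** [cite: Rubin1999, Cor. 5.5] -/
theorem apply_smul_eq_of_sqrt_mem {y : F} (hy : y ^ 2 = -(p : F))
    {s : AlgebraicClosure ℚ} {μ : AddMonoid.End W.geomPoints}
    (hs : s ^ 2 = ((-(p : ℤ) : ℤ) : AlgebraicClosure ℚ))
    (hcomm : ∀ g : absoluteGaloisGroup ℚ, g • s = s → ∀ P, μ (g • P) = g • μ P)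
    (g : absoluteGaloisGroup F) (X : geomPoints (W.baseChange F)) :
    RatClosure.pointsEquiv (K := F) W (μ ((RatClosure.pointsEquiv (K := F) W).symm (g • X))) =
      g • RatClosure.pointsEquiv (K := F) W (μ ((RatClosure.pointsEquiv (K := F) W).symm X)) := by
  set e := RatClosure.pointsEquiv (K := F) W with he
  have hfix := restrict_smul_sqrt_eq_of_sq_eq p F hy hs g
  obtain ⟨Y, rfl⟩ := e.surjective X
  rw [← RatClosure.pointsEquiv_smul, e.symm_apply_apply, e.symm_apply_apply, hcomm _ hfix,
    RatClosure.pointsEquiv_smul]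

/-- **The level-`p` central homothety over `F ∋ √−p`, `(p−1) ∤ [F:ℚ]`, on `W(F̄)[p]`** (file 9's
`exists_restrict_smul_eq_of_sqrt_mem`, transported along `RatClosure.torsionEquiv`).
[cite: GrigorovJorzaPatrikisSteinTarnita2009, Prop. 5.4 (mechanism)] -/
theorem exists_homothety_geomTorsion_of_sqrt_mem (hCM : W.HasCM) (h5 : 5 ≤ p) (hram : CMRamified W p)
    (hF : ∃ y : F, y ^ 2 = -(p : F)) (hdeg : ¬ (p - 1) ∣ Module.finrank ℚ F) :
    ∃ (g : absoluteGaloisGroup F) (d : ℤ), IsCoprime (d - 1) ((p : ℕ) : ℤ) ∧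
      ∀ t : geomTorsion (W.baseChange F) ((p : ℕ) : ℤ), g • t = d • t := by
  have hp' : _root_.Prime (p : ℤ) := Nat.prime_iff_prime_int.mp hp.out
  obtain ⟨g, d, hd1, hg⟩ := exists_restrict_smul_eq_of_sqrt_mem W p F hCM h5 hram hF hdeg
  refine ⟨g, d, ((Prime.coprime_iff_not_dvd hp').mpr hd1).symm, fun t => ?_⟩
  set θ := RatClosure.torsionEquiv (K := F) W ((p : ℕ) : ℤ) with hθ
  obtain ⟨t₀, rfl⟩ := θ.surjective t
  rw [← RatClosure.torsionEquiv_smul, ← map_zsmul]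
  congr 1
  exact Subtype.ext (by
    rw [AddSubgroupClass.coe_zsmul]
    exact hg _ (AddSubgroup.torsionBy.nsmul_iff.mp t₀.2))

/-- **The Kummer class of `P ∈ W(F)` leaves `W[𝔭]` iff `μ_F P ∉ p · W(F)`** (`F ∋ √−p`,
`(p−1) ∤ [F:ℚ]`). The direction needing thought: if `μ_F P = pR` with `R` fixed only by `Γ_{F(W[p])}`,
the Kummer class of `R` dies on `Γ_{F(W[p])}`, so vanishes by (α) over `F`
(`eq_zero_of_h1Eval_eq_zero_of_smul_eq` with the homothety of `exists_homothety_geomTorsion_of_sqrt_mem`),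
so `R ∈ W(F) + W[p]` (`kummerClassTorsion_eq_zero_iff`). [cite: GrossLMS1991, §9] [cite: SilvermanAEC2009, VIII.2] -/
theorem exists_h1Eval_kummer_ne_iff_not_mem_smul_of_sqrt_mem (hCM : W.HasCM) (h5 : 5 ≤ p)
    (hram : CMRamified W p) {s : AlgebraicClosure ℚ} {μ : AddMonoid.End W.geomPoints} {m : ℤ}
    (hs : s ^ 2 = ((-(p : ℤ) : ℤ) : AlgebraicClosure ℚ)) (hm : m.natAbs = p)
    (hμμ : ∀ P, μ (μ P) = m • P)
    (hcomm : ∀ g : absoluteGaloisGroup ℚ, g • s = s → ∀ P, μ (g • P) = g • μ P)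
    (hanti : ∀ g : absoluteGaloisGroup ℚ, g • s = -s → ∀ P, μ (g • P) = -(g • μ P))
    (hF : ∃ y : F, y ^ 2 = -(p : F)) (hdeg : ¬ (p - 1) ∣ Module.finrank ℚ F)
    {P : geomPoints (W.baseChange F)}
    (hP : P ∈ MulAction.fixedPoints (absoluteGaloisGroup F) (geomPoints (W.baseChange F)))
    (Q : geomPoints (W.baseChange F)) (hQP : (p : ℤ) • Q = P) :
    (∃ ρ ∈ torsionFixing (W.baseChange F) (p : ℤ),
        μ ((RatClosure.torsionEquiv (K := F) W (p : ℤ)).symm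
          (h1Eval (W.baseChange F) (p : ℤ) ((W.baseChange F).kummerClassTorsion (p : ℤ) Q
            (by rw [hQP]; exact hP)) ρ) : W.geomTorsion (p : ℤ)) ≠ 0) ↔
      ¬ ∃ R ∈ MulAction.fixedPoints (absoluteGaloisGroup F) (geomPoints (W.baseChange F)),
        RatClosure.pointsEquiv (K := F) W (μ ((RatClosure.pointsEquiv (K := F) W).symm P)) =
          (p : ℤ) • R := by
  have hpr : p.Prime := hp.out
  obtain ⟨y, hy⟩ := hF
  set e := RatClosure.pointsEquiv (K := F) W with he
  have key := exists_h1Eval_kummer_not_mem_iff_of_cmRamified W p F h5 hs hm hμμ hcomm hanti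
    (dvd_refl (p : ℤ)) 1 Q (by rw [hQP]; exact hP)
  simp only [pow_one] at key
  rw [key, hQP, not_iff_not]
  constructor
  · -- descent from `Γ_{F(W[p])}`-fixed to `Γ_F`-fixed
    rintro ⟨R, hRfix, hR⟩
    have hμP : e (μ (e.symm P)) ∈
        MulAction.fixedPoints (absoluteGaloisGroup F) (geomPoints (W.baseChange F)) := fun g => by
      rw [← apply_smul_eq_of_sqrt_mem W p F hy hs hcomm g P, hP g]
    have hpR : (p : ℤ) • R ∈ MulAction.fixedPoints (absoluteGaloisGroup F) (geomPoints (W.baseChange F)) := by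
      rw [← hR]; exact hμP
    -- the Kummer class of `R` dies on `Γ_{F(W[p])}`, hence is zero by (α)
    set x := (W.baseChange F).kummerClassTorsion (p : ℤ) R hpR with hx
    have hx0 : ∀ ρ ∈ torsionFixing (W.baseChange F) (p : ℤ), h1Eval (W.baseChange F) (p : ℤ) x ρ = 0 := by
      intro ρ hρ
      apply Subtype.ext
      rw [hx, coe_h1Eval_kummerClassTorsion (W.baseChange F) (p : ℤ) R hpR hρ, hRfix ρ hρ, sub_self]
      rfl
    obtain ⟨g₀, d, hd, hg₀⟩ := exists_homothety_geomTorsion_of_sqrt_mem W p F hCM h5 hram ⟨y, hy⟩ hdeg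
    haveI : (W.baseChange F).IsElliptic := by unfold WeierstrassCurve.baseChange; infer_instance
    have hxz : x = 0 := eq_zero_of_h1Eval_eq_zero_of_smul_eq (W.baseChange F) hpr.ne_zero hg₀ hd hx0
    obtain ⟨T, hT, hRT⟩ :=
      (WeierstrassCurve.kummerClassTorsion_eq_zero_iff (W.baseChange F) (p : ℤ) R hpR).mp hxz
    refine ⟨R - T, hRT, ?_⟩
    rw [smul_sub, (mem_geomTorsion_iff _ _ T).mp hT, sub_zero, hR]
  · rintro ⟨R, hRfix, hR⟩
    exact ⟨R, fun ρ _ => hRfix ρ, hR⟩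

/-- **END STATE: the Kummer class of `P ∈ W(F)` leaves the line `W[𝔭]` iff `P ∉ √−p · W(F)`.**
`W/ℚ` CM, `p ≥ 5` CM-ramified, `μ = √−p` with its sign rule (`exists_sqrt_end_of_cmRamified`), `F` a
number field with `√−p ∈ F` and `(p − 1) ∤ [F : ℚ]` (e.g. the compositum `K·K''`), `μ_F = e μ e⁻¹`
on `W(F̄)`, `P ∈ W(F)`, `pQ = P`. Then: some evaluation of `κ_Q ∈ H¹(F, W[p])` on `Γ_{F(W[p])}` lies
outside `W[𝔭]` — the `r = 1` hypothesis of `exists_h1Eval_eq_of_cmRamified_one` /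
`exists_h1Eval_conj_mul_eq_zero_iff_of_cmRamified` — **iff `P ≠ μ_F R` for every `R ∈ W(F)`**.
(From the previous theorem with `μ² = ±p` and `W[p]^{Γ_F} = 0`: `μ_F P = pR ⟺ P = ±μ_F R`.) Gross at
a surjective prime: `y_K ∉ p E(K)`; here: `y ∉ 𝔭 W(F)`. [cite: GrossLMS1991, §9 Prop. 9.3]
[cite: Rubin1999, Cor. 5.5, Lemma 6.2] -/
theorem exists_h1Eval_kummer_ne_iff_not_mem_range_of_sqrt_mem (hCM : W.HasCM) (h5 : 5 ≤ p)
    (hram : CMRamified W p) {s : AlgebraicClosure ℚ} {μ : AddMonoid.End W.geomPoints} {m : ℤ}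
    (hs : s ^ 2 = ((-(p : ℤ) : ℤ) : AlgebraicClosure ℚ)) (hm : m.natAbs = p)
    (hμμ : ∀ P, μ (μ P) = m • P)
    (hcomm : ∀ g : absoluteGaloisGroup ℚ, g • s = s → ∀ P, μ (g • P) = g • μ P)
    (hanti : ∀ g : absoluteGaloisGroup ℚ, g • s = -s → ∀ P, μ (g • P) = -(g • μ P))
    (hF : ∃ y : F, y ^ 2 = -(p : F)) (hdeg : ¬ (p - 1) ∣ Module.finrank ℚ F)
    {P : geomPoints (W.baseChange F)}
    (hP : P ∈ MulAction.fixedPoints (absoluteGaloisGroup F) (geomPoints (W.baseChange F)))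
    (Q : geomPoints (W.baseChange F)) (hQP : (p : ℤ) • Q = P) :
    (∃ ρ ∈ torsionFixing (W.baseChange F) (p : ℤ),
        μ ((RatClosure.torsionEquiv (K := F) W (p : ℤ)).symm
          (h1Eval (W.baseChange F) (p : ℤ) ((W.baseChange F).kummerClassTorsion (p : ℤ) Q
            (by rw [hQP]; exact hP)) ρ) : W.geomTorsion (p : ℤ)) ≠ 0) ↔
      ∀ R ∈ MulAction.fixedPoints (absoluteGaloisGroup F) (geomPoints (W.baseChange F)),
        P ≠ RatClosure.pointsEquiv (K := F) W (μ ((RatClosure.pointsEquiv (K := F) W).symm R)) := by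
  have hpr : p.Prime := hp.out
  obtain ⟨y, hy⟩ := hF
  set e := RatClosure.pointsEquiv (K := F) W with he
  rw [exists_h1Eval_kummer_ne_iff_not_mem_smul_of_sqrt_mem W p F hCM h5 hram hs hm hμμ hcomm hanti
    ⟨y, hy⟩ hdeg hP Q hQP, not_exists]
  -- `μ_F ∘ μ_F = m` on `W(F̄)` and `m = ± p`
  have hμμF : ∀ X : geomPoints (W.baseChange F), e (μ (e.symm (e (μ (e.symm X))))) = m • X := by
    intro X
    rw [e.symm_apply_apply, hμμ, map_zsmul, e.apply_symm_apply]
  have hμfix : ∀ X ∈ MulAction.fixedPoints (absoluteGaloisGroup F) (geomPoints (W.baseChange F)),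
      e (μ (e.symm X)) ∈ MulAction.fixedPoints (absoluteGaloisGroup F) (geomPoints (W.baseChange F)) :=
    fun X hX g => by rw [← apply_smul_eq_of_sqrt_mem W p F hy hs hcomm g X, hX g]
  -- `W[p]^{Γ_F} = 0` (the level-`p` homothety)
  obtain ⟨g₀, d, hd, hg₀⟩ := exists_homothety_geomTorsion_of_sqrt_mem W p F hCM h5 hram ⟨y, hy⟩ hdeg
  have hnoT : ∀ X : geomPoints (W.baseChange F), (p : ℤ) • X = 0 →
      X ∈ MulAction.fixedPoints (absoluteGaloisGroup F) (geomPoints (W.baseChange F)) → X = 0 := by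
    intro X hX hXfix
    have hXT : X ∈ geomTorsion (W.baseChange F) ((p : ℕ) : ℤ) := (mem_geomTorsion_iff _ _ X).mpr hX
    have h := eq_zero_of_forall_smul_eq_of_smul_eq (W.baseChange F) hg₀ hd ⟨X, hXT⟩
      (Subtype.ext (hXfix g₀))
    exact congrArg Subtype.val h
  rcases Int.natAbs_eq m with hmp | hmp <;> rw [hm] at hmp
  · -- `m = p`
    constructor
    · intro h R hR hPR
      refine h R ⟨hR, ?_⟩
      rw [hPR, hμμF, hmp]
    · intro h R ⟨hR, hμP⟩
      -- `p • (P - μ_F R) = 0` and `P - μ_F R` is `Γ_F`-fixed, hence zero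
      refine h R hR (sub_eq_zero.mp (hnoT _ ?_ fun g => ?_))
      · rw [smul_sub, ← hmp, ← hμμF P, hmp, hμP, map_zsmul, map_zsmul, map_zsmul]
        exact sub_self _
      · rw [smul_sub, hP g, hμfix R hR g]
  · -- `m = -p`
    constructor
    · intro h R hR hPR
      refine h (-R) ⟨fun g => by rw [smul_neg, hR g], ?_⟩
      rw [hPR, hμμF, hmp, neg_smul, smul_neg]
    · intro h R ⟨hR, hμP⟩
      refine h (-R) (fun g => by rw [smul_neg, hR g]) (sub_eq_zero.mp (hnoT _ ?_ fun g => ?_))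
      · rw [map_neg, map_neg, map_neg, sub_neg_eq_add, smul_add]
        have h1 : (p : ℤ) • P = -(e (μ (e.symm (e (μ (e.symm P)))))) := by
          rw [hμμF, hmp, neg_smul, neg_neg]
        rw [h1, hμP, map_zsmul, map_zsmul, map_zsmul, neg_add_cancel]
      · rw [map_neg, map_neg, map_neg, smul_sub, smul_neg, hP g, hμfix R hR g]

end Descent

end Summit.BirchSwinnertonDyer.BirchSwinnertonDyer.Theorems.PrintCFram.BorelKolyvaginPairing

end
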